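import Literature.NumberTheory.LFunctions.ThetaChainFreeCheck
import HarnessLib

/-!
# Schoenfeld's `θ`-bound on `[599, 10⁸]` by kernel computation: data-free run, chunk 14 of 35

Topic: `Literature/NumberTheory/LFunctions`. Pure proof file (a kernel computation; nothing is
asserted, no definition). The theorems below evaluate `ThetaChain.runFree` — together `150000`
data-free steps of the certified `θ`-chain (`ThetaChain.stepFree`, `ThetaChainFreeCheck.lean`: the
next prime found and certified by two gcds with the primorials of the odd primes `≤ 2999` and in
`(2999, 10007]`, the enclosures of `log p` and `θ(p)`, and the two comparisons behind
`|θ(x) − x| ≤ √x log² x/(8π)`) — from the state at the prime `41959069` to the state at the prime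
`44598077`. Soundness: `ThetaChain.runFree_sound`; assembly of the 35 chunks: `ThetaUpTo1e8.lean`.
The expected states were obtained by evaluating a twin of the same function outside the kernel
(validated bit-for-bit on the tree's chunk `ThetaChainRun.xrun14`). Declarations of `5·10⁴` steps
(about `70 s` of kernel time each; the kernel's evaluation is linear within a declaration of this size),
`decide +kernel`, standard axioms only (`maxHeartbeats 0` lifts the deterministic time-out).

## References

* L. Schoenfeld, *Sharper bounds for the Chebyshev functions θ(x) and ψ(x). II*, Math. Comp. 30
  (1976), 337–360, Thm. 10 (6.3). [Schoenfeld1976]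
* J. B. Rosser, L. Schoenfeld, *Approximate formulas for some functions of prime numbers*,
  Illinois J. Math. 6 (1962), 64–94, Thms. 18–19 (`θ`-tables to `10⁸`). [RosserSchoenfeld1962]
-/

namespace Literature.NumberTheory.LFunctions.ThetaChainRun

open ThetaChain

set_option maxHeartbeats 0 in
/-- **Data-free certified `θ`-run, chunk 14a** (steps `1950001`–`2000000` after `8886113`: 50000 primes,
`41959069` to `42836873`). [cite: Schoenfeld1976, Thm. 10 (6.3)] -/
theorem frun14a :
    runFree 50000
      ⟨41959069, 21219314001176385819177387, 21219314001176861477641359, 50717460226964554668697252498812, 50717460226965765317209840113226⟩ =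
    some ⟨42836873, 21244344393072508781565357, 21244344393072984440985714, 51779054025354921643837870572479, 51779054025356156075297567706278⟩ := by
  decide +kernel

set_option maxHeartbeats 0 in
/-- **Data-free certified `θ`-run, chunk 14b** (steps `2000001`–`2050000` after `8886113`: 50000 primes,
`42836873` to `43718329`). [cite: Schoenfeld1976, Thm. 10 (6.3)] -/
theorem frun14b :
    runFree 50000
      ⟨42836873, 21244344393072508781565357, 21244344393072984440985714, 51779054025354921643837870572479, 51779054025356156075297567706278⟩ =
    some ⟨43718329, 21268968025915981830402989, 21268968025916457490779136, 52841889241622913876520220515284, 52841889241624172090974835913378⟩ := by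
  decide +kernel

set_option maxHeartbeats 0 in
/-- **Data-free certified `θ`-run, chunk 14c** (steps `2050001`–`2100000` after `8886113`: 50000 primes,
`43718329` to `44598077`). [cite: Schoenfeld1976, Thm. 10 (6.3)] -/
theorem frun14c :
    runFree 50000
      ⟨43718329, 21268968025915981830402989, 21268968025916457490779136, 52841889241622913876520220515284, 52841889241624172090974835913378⟩ =
    some ⟨44598077, 21293053816997555200422638, 21293053816998030861754505, 53905941993206703394159255090309, 53905941993207985391656577212393⟩ := by
  decide +kernel

end Literature.NumberTheory.LFunctions.ThetaChainRun
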